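import Summits.Parity.GeneralizedHardyLittlewood.Theses.DeterminantMoebiusCores

/-!
# Birth skeleton (BC3) for the crux `PairCores` — route `DeterminantMoebiusCores`, item stmt-Parity-15171

Line `birth` (skeleton registrar planner-skel-stmt-Parity-15171-0, 2026-08-17) = the HYPERBOLIC
TRICHOTOMY of the opened two-point core, i.e. the route's own "centre / long lines / short lines"
organisation of the twin test-bed (retired route `DeterminantMoebius`: CentreKloosterman,
DilatedChowlaLongLines, CoreShortLines) transported to the general crux, where the truncation
`P = N^θ` is small and a third, provable, regime appears.

**The chart.** `Λ♯(ψ₁(n)) Λ♯(ψ₂(n)) = ∑_{d₁ ∣ ψ₁(n), d₂ ∣ ψ₂(n), dᵢ > N^θ} μ(d₁) μ(d₂) log(ψ₁(n)/d₁) log(ψ₂(n)/d₂)`.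
The four variables `(d₁, e₁ = ψ₁/d₁, d₂, e₂ = ψ₂/d₂)` live on the determinant-type variety
`a₂·d₁e₁ − a₁·d₂e₂ = a₂b₁ − a₁b₂ ≠ 0` (non-degeneracy); Möbius sits on `(d₁,d₂)`, smooth log-weights
on `(e₁,e₂)`. For `n` in a progression mod `q ≤ N^ν` inside `[−N, N]`, fixing `(d₁,d₂)` leaves a
d-LINE of `≍ N/(q d₁d₂)` values of `n` on which the summand is SMOOTH, fixing `(e₁,e₂)` leaves an
e-LINE of `≍ d₁d₂/(qN)` values of `n` on which the summand is `μ(d₁(n)) μ(d₂(n))`. Cut the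
`(d₁,d₂)`-sum by the size of the product `D = d₁d₂` at `N^{1−η}` and `N^{1+η}` with `η > ν` (so the
long family always has length `≥ N^{η−ν} → ∞`); the cut is by the product so that it commutes with
the level-`q` frame of the crux (same tame indicator, same divisor weight, same intervals):

* `stub_smoothSide` — `D ≤ N^{1−η}`, "doubly Type I", PROVABLE with classical tools (L–XL in Lean).
  Along a long d-line the `n`-sum is a lattice-point count with log-weights (error `O(log² N)` per
  line and residue class, `N^{1−η+ν+o(1)}` in total), and the main terms are
  `∑_{d₁d₂ ≤ N^{1−η}, dᵢ > N^θ} μ(d₁)μ(d₂) ρ_{q,r}(d₁,d₂)/(d₁d₂) × (polynomial in log dᵢ)`: TAILS of the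
  convergent Möbius series `∑ μ(d)/d = 0`, `∑ μ(d) log d/d = −1` (PNT rates `(log)^{−B}`), twisted by
  local densities `ρ` which on a TAME class involve only the shared part `g = gcd(ψᵢ(r_q), q) ≤ N^{θ/2}`,
  so every tail starts at `≥ N^θ/g ≥ N^{θ/2}` and is `≪_B (log N)^{−B}` uniformly: the class mean
  vanishes to every power of `log N` (refuter rreview1's paper check of the repair, REVIEW.md on the
  item). This is the `T_∅`/truncated-singular-series mathematics of `OpeningReduction`, and exactly
  where tameness is consumed: on a class forcing a prime `p ∈ (N^θ/2, N^θ]` the tail becomes a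
  COMPLETE series with the first-order constant `−∑μ(d) log d/d = 1` (the rattack-14636 witness).
* `stub_centre` — `N^{1−η} < D ≤ N^{1+η}`: both line families are short, the genuinely
  two-dimensional DETERMINANT regime; `∃ η > ν` of the prover's choosing. At `ν = 0` the balanced box
  `d₁ ≈ d₂ ≈ √N` is Duke–Friedlander–Iwaniec, 'Representations by the determinant' Thm 1 (μ on the
  lower row, log-weights on the upper row, power saving; GreavesHarmanHuxley1997 p. 83), and the
  lopsided part `min dᵢ ≤ N^{1/3−δ}` is Bombieri–Vinogradov for `μ` along the `(e₁,d₂)`-solutions of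
  the linear equation `a₂d₁·e₁ − a₁e₂·d₂ = Δ` (one live Möbius variable in a progression of modulus
  `≍ d₁ ≤ (length)^{1/2−}`); the band `N^{1/3} < min dᵢ < N^{5/11}` at `D ≈ N`, and every `ν > 0`, need a
  dispersion-type input that is not in print. Size XL; theorem-grade in part, open in part.
* `stub_moebiusSide` — `D > N^{1+η}`, "doubly Type II", OPEN — the LOAD-BEARING stub, exactly as
  hard as the crux is meant to be: e-lines `n ↦ (ψ₁(n)/e₁, ψ₂(n)/e₂)` of length `≥ N^{η−ν}/4L²` carry
  `μ(d₁(n)) μ(d₂(n))` — signed two-point Möbius correlations along pairs of dilated progressions,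
  summed over `(e₁,e₂)` with weights `log e₁ log e₂`, with a `(log N)^{−A}` saving at level `ν` on tame
  classes; `e₁ = e₂ = 1` alone is Cesàro pair-Chowla `∑ₙ μ(ψ₁(n)) μ(ψ₂(n)) log ψ₁(n) log ψ₂(n)` with a
  `(log N)^{A+2}` saving — HL-pair complete (TaoFMP2016 / HelfgottRadziwill2021 / Pilatte2026 give
  log-averaged `o(1)` only; SawinShusterman2018 Thm 1.1/4.5 prove the `𝔽_q[T]` analogue with a power
  saving, uniformly in dilations).

`PairCores_of` (REAL proof, no `sorry`, conclusion literally the route decl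
`Summit.Parity.GeneralizedHardyLittlewood.Theses.DeterminantMoebiusCores.PairCores`): take `η` and
`N_B` from `stub_centre` at saving `A+1`, then `N_A`, `N_C` from the other two stubs at `(A+1, η)`,
`N₀ = max(N_A, N_B, N_C, 32)`; the identity `Λ♯Λ♯ = core_{≤N^{1−η}} + core_{(N^{1−η},N^{1+η}]} +
core_{>N^{1+η}}` (`lamSharp_mul_split`, a finite-sum identity needing only `N^{1−η} ≤ N^{1+η}`), the
triangle inequality inside the tame indicator and the divisor weight (`weighted_sum_le_of_split`),
and `3N/(log N)^{A+1} ≤ N/(log N)^A` for `N ≥ 32` (`three_terms_bound`, `log 32 = 5 log 2 > 3`).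

**Hardest stub:** `stub_moebiusSide` (contains Cesàro pair-Chowla with a log-power RATE, level `ν`,
shift-uniform: Siegel-sensitive exactly like the crux — MatomakiMerikoski2023 Thm 1.3).

**Barriers.** SelbergParityBarrier / PrimePairParity: nothing about primes is deduced from
distribution data — `stub_smoothSide` and `stub_centre` are Möbius statements with at most ONE live
Möbius variable per line (tails of `∑μ(d)/d`, BV for `μ`, Kloosterman), parity-insensitive and
provable in kind, while ALL the parity content sits undiluted in `stub_moebiusSide` (signed
two-point Möbius cancellation): the barrier is paid there, not evaded, as the route header says
(`bombieri_asymptotic_sieve_indeterminacy`). LargeSieveLevelHalf: every modulus is `≤ N^ν`,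
`ν + θ < 1/2`, untouched by the cut. FordFixedLevelBarrier / FordMaynardMinimalTypeII: not engaged (no
sieve weights; the Type II information is requested explicitly). LogarithmicAveraging: the Cesàro,
log-power form of `stub_moebiusSide` is precisely what log-averaged Chowla does not supply — noted,
not evaded.

**Disproof used:** none exists — `ledger crux ls stmt-Parity-15171`: no workfiles (no
`Disproof.lean`, no `_false_without_` theorem, no `Theorems/PairCores/Negative/*`) at registration,
2026-08-17. **Negatives index** (`ledger negatives --problem Parity`: ConvMomentLevelOne 9541,
TupleElliott 14832, RectangleChowla 4218): no stub is an instance — no convolution moment, no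
pretentious-uniform Elliott slot, no `ℓ²` rectangle of `λ`-correlations; the only `ℓ¹` structure is
the crux's own tame frame, kept verbatim. **Dead lines:** none recorded for this crux. Item evidence
read: REPAIR_NOTE.md (whole-gcd tameness), REVIEW.md + numerics_runs.txt (tame class means vanish:
`|E| ≤ 0.034`, two-point `|F|/log²N ≤ 0.002` at `N = 8·10⁶`, `θ = 0.4`).

**Cheapest falsifier.** (i) `stub_smoothSide`: rerun the refuter's tame-class numerics
(numerics_runs.txt) with the divisor window `d₁d₂ ≤ N^{1−η}` only, on tame classes `g = 6, 30` and
`q = 1`: the windowed mean must vanish like the full tame mean; an `O(1)` relative mean on a tame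
class kills the CUT (move it), not the line. (ii) `stub_moebiusSide` at `ν = 0`, `Ψ = (n, n+2)`,
`θ = 0.45`: it is TwinCores' CORE minus provable pieces — route falsifier (2), `CORE/x → 0`.

**BC3 audit (this seat, 2026-08-17, farm `lean check --json`):** rc 0, errors `[]`, `sorries` 3 =
exactly `stub_smoothSide`, `stub_centre`, `stub_moebiusSide` (sorry count = stub count, zero elsewhere);
`PairCores_of` axioms `[propext, Classical.choice, Quot.sound]` (no `sorryAx`); skeleton-audit preview
`#h21_check_skeleton`: `ok: true`, theorem `PairCores_of`, codes `[]`. PROBES (self-contained files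
`bc/probe_<stub>_<crux|summit>.lean` + `bc/probe_defeq.lean` in the seat folder; only the route file
imported, no sibling stub / composition in scope), for each of the 3 stubs against BOTH `PairCores` and
`GeneralizedHardyLittlewood`: (P0) `first | exact? | simpa | aesop` at 400 000 heartbeats — FAIL 6/6
(4× "unsolved goals" after aesop's exhaustive search; 2× heartbeat exhaustion inside `exact?` for
smoothSide/moebiusSide → PairCores); each alternative alone at 10⁶ heartbeats — `exact?` FAIL 6/6
("could not close the goal" 4×, no proof within 10⁶ heartbeats 2×), `simpa` FAIL 6/6 ("assumption
failed"), `aesop` FAIL 6/6 ("failed after exhaustive search"); unfolded variants `simpa [StubSig, target]`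
and `unfold StubSig target; aesop` FAIL 6/6; definitional `example (a : StubSig) : target := a` — "Type
mismatch" 6/6. No stub is cheaply (or definitionally) the crux or the summit. Raw outputs: seat NOTES.md
`birth-certificate:`.
-/

set_option linter.unusedVariables false

namespace Summit.Parity.GeneralizedHardyLittlewood.Cruxes.PairCores.Birth

open scoped BigOperators Topology Manifold Classical MeasureTheory ProbabilityTheory Matrix InnerProductSpace ComplexConjugate ContinuousMap
open Filter Set Function TopologicalSpace MeasureTheory
open Summit.Parity.GeneralizedHardyLittlewood.Theses.DeterminantMoebiusCores

/-! ### The opened core and its hyperbolic windows (definitions unfold to the crux's own terms) -/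

/-- The summand of the crux's inlined `Λ♯_{N^θ}`: `[N^θ < d] · μ(d) · log(m/d)`. -/
noncomputable def sharpTerm (N : ℕ) (θ : ℝ) (m d : ℕ) : ℝ :=
  if (N : ℝ) ^ θ < (d : ℝ) then (ArithmeticFunction.moebius d : ℝ) * Real.log ((m : ℝ) / (d : ℝ)) else 0

/-- `Λ♯_{N^θ}(m) = ∑_{d ∣ m, d > N^θ} μ(d) log(m/d)` — by unfolding, literally the crux's factor at
`m = (ψᵢ(n)).toNat`. -/
noncomputable def lamSharp (N : ℕ) (θ : ℝ) (m : ℕ) : ℝ :=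
  ∑ d ∈ Nat.divisors m, sharpTerm N θ m d

/-- The opened two-point core `Λ♯(m₁) Λ♯(m₂) = ∑_{d₁ ∣ m₁} ∑_{d₂ ∣ m₂} …` restricted to the pairs of
Möbius variables whose product `d₁ d₂` (read in `ℝ`) lies in the window `S`. -/
noncomputable def coreOn (N : ℕ) (θ : ℝ) (S : Set ℝ) (m₁ m₂ : ℕ) : ℝ :=
  ∑ d₁ ∈ Nat.divisors m₁, ∑ d₂ ∈ Nat.divisors m₂,
    if ((d₁ * d₂ : ℕ) : ℝ) ∈ S then sharpTerm N θ m₁ d₁ * sharpTerm N θ m₂ d₂ else 0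

/-- HYPERBOLIC TRICHOTOMY of the opened core (an identity of finite sums): smooth side
`d₁d₂ ≤ X₁`, centre `X₁ < d₁d₂ ≤ X₂`, Möbius side `d₁d₂ > X₂`. [bookkeeping] -/
theorem lamSharp_mul_split (N : ℕ) (θ : ℝ) {X₁ X₂ : ℝ} (hX : X₁ ≤ X₂) (m₁ m₂ : ℕ) :
    lamSharp N θ m₁ * lamSharp N θ m₂ =
      coreOn N θ (Set.Iic X₁) m₁ m₂ + coreOn N θ (Set.Ioc X₁ X₂) m₁ m₂ +
        coreOn N θ (Set.Ioi X₂) m₁ m₂ := by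
  unfold lamSharp coreOn
  rw [Finset.sum_mul_sum, ← Finset.sum_add_distrib, ← Finset.sum_add_distrib]
  refine Finset.sum_congr rfl fun d₁ _ => ?_
  rw [← Finset.sum_add_distrib, ← Finset.sum_add_distrib]
  refine Finset.sum_congr rfl fun d₂ _ => ?_
  simp only [Set.mem_Iic, Set.mem_Ioc, Set.mem_Ioi]
  by_cases h₁ : ((d₁ * d₂ : ℕ) : ℝ) ≤ X₁
  · have h₂ : ¬ (X₁ < ((d₁ * d₂ : ℕ) : ℝ) ∧ ((d₁ * d₂ : ℕ) : ℝ) ≤ X₂) :=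
      fun h => absurd h.1 (not_lt.mpr h₁)
    have h₃ : ¬ X₂ < ((d₁ * d₂ : ℕ) : ℝ) := not_lt.mpr (h₁.trans hX)
    rw [if_pos h₁, if_neg h₂, if_neg h₃]
    ring
  · have h₁' : X₁ < ((d₁ * d₂ : ℕ) : ℝ) := not_le.mp h₁
    by_cases h₂ : ((d₁ * d₂ : ℕ) : ℝ) ≤ X₂
    · have h₃ : ¬ X₂ < ((d₁ * d₂ : ℕ) : ℝ) := not_lt.mpr h₂
      rw [if_neg h₁, if_pos ⟨h₁', h₂⟩, if_neg h₃]
      ring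
    · have h₂' : X₂ < ((d₁ * d₂ : ℕ) : ℝ) := not_le.mp h₂
      have h₃ : ¬ (X₁ < ((d₁ * d₂ : ℕ) : ℝ) ∧ ((d₁ * d₂ : ℕ) : ℝ) ≤ X₂) :=
        fun h => absurd h.2 h₂
      rw [if_neg h₁, if_neg h₃, if_pos h₂']
      ring

/-- The `ℓ¹`-over-moduli frame of the crux (divisor weight `w ≥ 0`, tame indicator `T`, one residue
class `I q` per modulus) is subadditive under a three-way split of the summand: triangle
inequality inside the indicator. [bookkeeping] -/
theorem weighted_sum_le_of_split {s : Finset ℕ} {I : ℕ → Finset ℤ} {w : ℕ → ℝ}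
    (hw : ∀ q, 0 ≤ w q) {T : ℕ → Prop} {_hT : DecidablePred T} {F FA FB FC : ℕ → ℤ → ℝ}
    (hF : ∀ q ∈ s, ∀ n ∈ I q, F q n = FA q n + FB q n + FC q n) :
    ∑ q ∈ s, w q * (if T q then |∑ n ∈ I q, F q n| else 0) ≤
      ∑ q ∈ s, w q * (if T q then |∑ n ∈ I q, FA q n| else 0) +
        ∑ q ∈ s, w q * (if T q then |∑ n ∈ I q, FB q n| else 0) +
          ∑ q ∈ s, w q * (if T q then |∑ n ∈ I q, FC q n| else 0) := by
  rw [← Finset.sum_add_distrib, ← Finset.sum_add_distrib]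
  refine Finset.sum_le_sum fun q hq => ?_
  rw [← mul_add, ← mul_add]
  refine mul_le_mul_of_nonneg_left ?_ (hw q)
  split_ifs with hTq
  · calc |∑ n ∈ I q, F q n|
          = |∑ n ∈ I q, FA q n + ∑ n ∈ I q, FB q n + ∑ n ∈ I q, FC q n| := by
            rw [← Finset.sum_add_distrib, ← Finset.sum_add_distrib]
            exact congrArg _ (Finset.sum_congr rfl (hF q hq))
      _ ≤ |∑ n ∈ I q, FA q n| + |∑ n ∈ I q, FB q n| + |∑ n ∈ I q, FC q n| := abs_add_three _ _ _
  · simp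

/-- `log N ≥ 3` once `N ≥ 32` (`log 32 = 5 log 2 > 3.46`). [bookkeeping] -/
theorem three_le_log {N : ℕ} (hN : 32 ≤ N) : (3 : ℝ) ≤ Real.log N := by
  have h32 : (32 : ℝ) ≤ (N : ℝ) := by exact_mod_cast hN
  have hlog : Real.log 32 ≤ Real.log (N : ℝ) := Real.log_le_log (by norm_num) h32
  have h2 : Real.log (32 : ℝ) = 5 * Real.log 2 := by
    rw [show (32 : ℝ) = 2 ^ 5 by norm_num, Real.log_pow]
    norm_num
  have := Real.log_two_gt_d9
  linarith

/-- Three savings of `(log N)^{-(A+1)}` make one saving of `(log N)^{-A}` once `log N ≥ 3`.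
[bookkeeping] -/
theorem three_terms_bound {N : ℕ} (hN : 32 ≤ N) (A : ℝ) :
    (N : ℝ) / Real.log N ^ (A + 1) + (N : ℝ) / Real.log N ^ (A + 1) +
        (N : ℝ) / Real.log N ^ (A + 1) ≤ (N : ℝ) / Real.log N ^ A := by
  have h3 := three_le_log hN
  have hpos : 0 < Real.log N := by linarith
  rw [Real.rpow_add hpos, Real.rpow_one, div_mul_eq_div_div]
  have hX : 0 ≤ (N : ℝ) / Real.log N ^ A :=
    div_nonneg (Nat.cast_nonneg _) (Real.rpow_nonneg hpos.le _)
  have hq : 3 / Real.log N ≤ 1 := (div_le_one hpos).mpr h3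
  calc (N : ℝ) / Real.log N ^ A / Real.log N + (N : ℝ) / Real.log N ^ A / Real.log N +
        (N : ℝ) / Real.log N ^ A / Real.log N
        = (N : ℝ) / Real.log N ^ A * (3 / Real.log N) := by ring
    _ ≤ (N : ℝ) / Real.log N ^ A * 1 := mul_le_mul_of_nonneg_left hq hX
    _ = (N : ℝ) / Real.log N ^ A := mul_one _

/-! ### The three registered stubs (the ONLY `sorry`s of this file)

Each stub is the crux's own level-`ν`, tame-class, divisor-weighted `ℓ¹` frame — copied symbol for
symbol — around ONE hyperbolic window of the opened core. -/

/-- **Stub 1 — SMOOTH SIDE `d₁d₂ ≤ N^{1−η}` (doubly Type I; PROVABLE, L–XL).** For every `η > ν`: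
on tame classes the part of the two-point `Λ♯`-core carried by Möbius pairs with `d₁d₂ ≤ N^{1−η}` has
level `ν` with arbitrary log-power saving. Why true: for fixed `(d₁,d₂)` the `n`-sum runs over
`≤ L²`-many residue classes of modulus `≍ q d₁ d₂ ≤ N^{1−η+ν}` in an interval of length `≤ 2N`, with the
SMOOTH weight `log(ψ₁(n)/d₁) log(ψ₂(n)/d₂)`: lattice count + partial summation, error `O(log² N)` per
class, `≪ N^{1−η+ν+o(1)}` after the `τ(q)^C`-weighted `q`-sum (`η > ν`); main terms
`(|I|/q) ∑ μ(d₁)μ(d₂) ρ_{q,r}(d₁,d₂)/(d₁d₂) · P(log d₁, log d₂)` are tails over `dᵢ > N^θ/gᵢ ≥ N^{θ/2}`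
(tame: shared part `gᵢ ≤ N^{θ/2}`) of the convergent series `∑ μ(d)χ₀(d)/d`, `∑ μ(d)χ₀(d) log d/d`
(principal twists to moduli `∣ q a₁a₂(a₁b₂−a₂b₁)`), each `≪_B (log N)^{−B}` by the prime number theorem
with classical error term, uniformly (q-smooth counts `N^{o(1)}`); the coupling of `d₁, d₂` through a
common prime `p` (possible only for `p ∣ Δ = a₁b₂ − a₂b₁`, at density `1/p`, or `p ∣ q` forced by the
class) is harmless on tame classes: either `p > N^{θ/2}` and the factor `1/p` (resp. tameness) wins, or
the tails still start above `N^{θ/2}`; intrinsic forced primes `p ∣ (aᵢ, bᵢ)` are `≤ L`. Leans on: Mathlib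
`ArithmeticFunction.moebius`, PNT-rate Möbius sums (tree: `siegel_walfisz_holds`-strength inputs;
Literature `SingularSeries`), the refuter's tame-class computation (REVIEW.md on stmt-Parity-15171).
Why it might fail: only through the FORM (a tame class whose windowed mean is not `o((log N)^{−A})` —
then the window, not the line, moves). [cite: GoldstonYildirim2001 / arXiv:math/0111212, Lemma 2.1;
BombieriAsymptoticSieve1976; IwaniecKowalski2004, §5.6] -/
theorem stub_smoothSide :
    ∀ (L : ℕ) (θ ν A C η : ℝ), 0 < θ → 0 ≤ ν → ν + θ < 1 / 2 → 0 < A → 0 ≤ C → ν < η →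
      ∃ N₀ : ℕ, ∀ N : ℕ, N₀ ≤ N → ∀ Ψ : Fin 2 → Literature.NumberTheory.Sieve.AffLinForm 1,
        Literature.NumberTheory.Sieve.IsNondegenerateSystem Ψ →
        Literature.NumberTheory.Sieve.affLinSize Ψ N ≤ L →
        ∀ (r u v : ℕ → ℤ), (∀ q : ℕ, -(N : ℤ) ≤ u q ∧ v q ≤ N) →
          ∑ q ∈ Finset.Icc 1 ⌊(N : ℝ) ^ ν⌋₊, ((Nat.divisors q).card : ℝ) ^ C *
            (if ∀ i : Fin 2, ((Int.gcd ((Ψ i).eval (fun _ => r q)) q : ℕ) : ℝ) ≤ (N : ℝ) ^ (θ / 2) then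
              |∑ n ∈ (Finset.Icc (u q) (v q)).filter (fun n : ℤ => (q : ℤ) ∣ n - r q),
                coreOn N θ (Set.Iic ((N : ℝ) ^ (1 - η)))
                  ((Ψ 0).eval (fun _ => n)).toNat ((Ψ 1).eval (fun _ => n)).toNat|
            else 0) ≤ (N : ℝ) / Real.log N ^ A := by
  sorry

/-- **Stub 2 — THE DETERMINANT CENTRE `N^{1−η} < d₁d₂ ≤ N^{1+η}` (both line families short; XL,
theorem-grade in part, open in part).** For some `η > ν` of the prover's choosing, the centre of the
two-point `Λ♯`-core has level `ν` on tame classes with arbitrary log-power saving. Why plausible: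
here `d₁d₂ ≍ N ≍ e₁e₂·O(L²)`, the regime of the determinant equation `a₂·d₁e₁ − a₁·d₂e₂ = a₂b₁ − a₁b₂`
with all four variables 'visible'. At `ν = 0`: the balanced box `N^{5/11} ≲ dᵢ ≲ N^{6/11}` is
Duke–Friedlander–Iwaniec 1997 Thm 1 (lower row `(d₁,d₂)` with `μ`, upper row `(e₁,e₂)` with the
log-weights after `(log N)^6` short-range decoupling; error `‖α‖‖β‖(d₁d₂)^{3/8}(d₁+d₂)^{11/48}N^{o(1)} =
o(N)`; zero-frequency main term = Möbius tails as in Stub 1); the lopsided boxes `min dᵢ ≤ N^{1/3−δ}`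
are Bombieri–Vinogradov for `μ`: fix the two small variables `(d₁, e₂)`, the large pair `(e₁, d₂)` runs
over the solutions of a linear equation, i.e. `d₂` over a progression of modulus `≍ d₁ ≤ (N/d₁)^{1/2−}`,
one live Möbius variable. Open part: the band `N^{1/3} < min dᵢ < N^{5/11}` and every level `ν > 0`
(residue classes varying with the modulus: a dispersion input of Bombieri–Friedlander–Iwaniec type,
not in print for this variety). Why it might fail: at `ν = 0`, given Stubs 1 and 3, it is equivalent to
the Hardy–Littlewood asymptotic for `Ψ` (the `t = 2` bookkeeping of `OpeningReduction`/`TwinReduction`), so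
a failure at level `0` refutes HL; at `ν > 0` a failure would sit in the FORM (window too wide for the
chosen `η` — hence `∃ η` — or a residual tame-class bias, as for the crux).
[cite: DukeFriedlanderIwaniec1997Determinant, Thm 1 (GreavesHarmanHuxley1997 p. 83);
BombieriFriedlanderIwaniecActa1986; BettinChandee2018; IwaniecKowalski2004, Thm 17.4 (BV for μ)] -/
theorem stub_centre :
    ∀ (L : ℕ) (θ ν A C : ℝ), 0 < θ → 0 ≤ ν → ν + θ < 1 / 2 → 0 < A → 0 ≤ C →
      ∃ η : ℝ, ν < η ∧ ∃ N₀ : ℕ, ∀ N : ℕ, N₀ ≤ N → ∀ Ψ : Fin 2 → Literature.NumberTheory.Sieve.AffLinForm 1,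
        Literature.NumberTheory.Sieve.IsNondegenerateSystem Ψ →
        Literature.NumberTheory.Sieve.affLinSize Ψ N ≤ L →
        ∀ (r u v : ℕ → ℤ), (∀ q : ℕ, -(N : ℤ) ≤ u q ∧ v q ≤ N) →
          ∑ q ∈ Finset.Icc 1 ⌊(N : ℝ) ^ ν⌋₊, ((Nat.divisors q).card : ℝ) ^ C *
            (if ∀ i : Fin 2, ((Int.gcd ((Ψ i).eval (fun _ => r q)) q : ℕ) : ℝ) ≤ (N : ℝ) ^ (θ / 2) then
              |∑ n ∈ (Finset.Icc (u q) (v q)).filter (fun n : ℤ => (q : ℤ) ∣ n - r q),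
                coreOn N θ (Set.Ioc ((N : ℝ) ^ (1 - η)) ((N : ℝ) ^ (1 + η)))
                  ((Ψ 0).eval (fun _ => n)).toNat ((Ψ 1).eval (fun _ => n)).toNat|
            else 0) ≤ (N : ℝ) / Real.log N ^ A := by
  sorry

/-- **Stub 3 — MÖBIUS SIDE `d₁d₂ > N^{1+η}` (doubly Type II; OPEN — the load-bearing stub).** For
every `η > ν`: the part of the two-point `Λ♯`-core carried by Möbius pairs with `d₁d₂ > N^{1+η}` — i.e.
by e-lines `n ↦ (ψ₁(n)/e₁, ψ₂(n)/e₂)`, `e₁e₂ ≤ 4L²N^{1−η}`, of length `≥ N^{η−ν}/4L²`, along which BOTH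
Möbius arguments move — has level `ν` on tame classes with arbitrary log-power saving: signed
two-point Möbius cancellation along pairs of dilated progressions, summed over the line family with
weights `log e₁ log e₂`. The pair `e₁ = e₂ = 1` alone is Cesàro pair-Chowla
`∑ₙ μ(ψ₁(n))μ(ψ₂(n)) log ψ₁(n) log ψ₂(n) ≪ N (log N)^{−A}`; short e-lines (`e₁e₂` near `N^{1−η}`) are the
'BDH for Möbius pairs on the determinant variety' of the retired route's CoreVariance. Why plausible:
it is the crux minus two regimes provable in kind; true over `𝔽_q[T]` with a power saving, uniformly
in the dilations (Sawin–Shusterman Thm 1.1/4.5). Why it might fail: everything that threatens the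
crux threatens this stub — Siegel zeros vs shift-uniform log-power savings (MatomakiMerikoski2023
Thm 1.3); only log-averaged `o(1)` two-point Chowla is known (TaoFMP2016, HelfgottRadziwill2021,
Pilatte2026); no signed cross-line engine. Size: open problem (HL-pair complete at `ν = 0`).
[cite: SawinShusterman2018, Thm 1.1, Thm 4.5; TaoFMP2016; MatomakiRadziwillTao2015; Pilatte2026;
MatomakiMerikoski2023, Thm 1.3; Polymath8b2014] -/
theorem stub_moebiusSide :
    ∀ (L : ℕ) (θ ν A C η : ℝ), 0 < θ → 0 ≤ ν → ν + θ < 1 / 2 → 0 < A → 0 ≤ C → ν < η →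
      ∃ N₀ : ℕ, ∀ N : ℕ, N₀ ≤ N → ∀ Ψ : Fin 2 → Literature.NumberTheory.Sieve.AffLinForm 1,
        Literature.NumberTheory.Sieve.IsNondegenerateSystem Ψ →
        Literature.NumberTheory.Sieve.affLinSize Ψ N ≤ L →
        ∀ (r u v : ℕ → ℤ), (∀ q : ℕ, -(N : ℤ) ≤ u q ∧ v q ≤ N) →
          ∑ q ∈ Finset.Icc 1 ⌊(N : ℝ) ^ ν⌋₊, ((Nat.divisors q).card : ℝ) ^ C *
            (if ∀ i : Fin 2, ((Int.gcd ((Ψ i).eval (fun _ => r q)) q : ℕ) : ℝ) ≤ (N : ℝ) ^ (θ / 2) then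
              |∑ n ∈ (Finset.Icc (u q) (v q)).filter (fun n : ℤ => (q : ℤ) ∣ n - r q),
                coreOn N θ (Set.Ioi ((N : ℝ) ^ (1 + η)))
                  ((Ψ 0).eval (fun _ => n)).toNat ((Ψ 1).eval (fun _ => n)).toNat|
            else 0) ≤ (N : ℝ) / Real.log N ^ A := by
  sorry

/-! ### Stub signatures as propositions (verbatim the statements above; named `Sig.stub_<name>` so that the
composition's hypotheses are the registered stubs BY NAME for the skeleton audit) -/

/-- Signature of `stub_smoothSide`. -/
def Sig.stub_smoothSide : Prop :=
    ∀ (L : ℕ) (θ ν A C η : ℝ), 0 < θ → 0 ≤ ν → ν + θ < 1 / 2 → 0 < A → 0 ≤ C → ν < η →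
      ∃ N₀ : ℕ, ∀ N : ℕ, N₀ ≤ N → ∀ Ψ : Fin 2 → Literature.NumberTheory.Sieve.AffLinForm 1,
        Literature.NumberTheory.Sieve.IsNondegenerateSystem Ψ →
        Literature.NumberTheory.Sieve.affLinSize Ψ N ≤ L →
        ∀ (r u v : ℕ → ℤ), (∀ q : ℕ, -(N : ℤ) ≤ u q ∧ v q ≤ N) →
          ∑ q ∈ Finset.Icc 1 ⌊(N : ℝ) ^ ν⌋₊, ((Nat.divisors q).card : ℝ) ^ C *
            (if ∀ i : Fin 2, ((Int.gcd ((Ψ i).eval (fun _ => r q)) q : ℕ) : ℝ) ≤ (N : ℝ) ^ (θ / 2) then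
              |∑ n ∈ (Finset.Icc (u q) (v q)).filter (fun n : ℤ => (q : ℤ) ∣ n - r q),
                coreOn N θ (Set.Iic ((N : ℝ) ^ (1 - η)))
                  ((Ψ 0).eval (fun _ => n)).toNat ((Ψ 1).eval (fun _ => n)).toNat|
            else 0) ≤ (N : ℝ) / Real.log N ^ A

/-- Signature of `stub_centre`. -/
def Sig.stub_centre : Prop :=
    ∀ (L : ℕ) (θ ν A C : ℝ), 0 < θ → 0 ≤ ν → ν + θ < 1 / 2 → 0 < A → 0 ≤ C →
      ∃ η : ℝ, ν < η ∧ ∃ N₀ : ℕ, ∀ N : ℕ, N₀ ≤ N → ∀ Ψ : Fin 2 → Literature.NumberTheory.Sieve.AffLinForm 1,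
        Literature.NumberTheory.Sieve.IsNondegenerateSystem Ψ →
        Literature.NumberTheory.Sieve.affLinSize Ψ N ≤ L →
        ∀ (r u v : ℕ → ℤ), (∀ q : ℕ, -(N : ℤ) ≤ u q ∧ v q ≤ N) →
          ∑ q ∈ Finset.Icc 1 ⌊(N : ℝ) ^ ν⌋₊, ((Nat.divisors q).card : ℝ) ^ C *
            (if ∀ i : Fin 2, ((Int.gcd ((Ψ i).eval (fun _ => r q)) q : ℕ) : ℝ) ≤ (N : ℝ) ^ (θ / 2) then
              |∑ n ∈ (Finset.Icc (u q) (v q)).filter (fun n : ℤ => (q : ℤ) ∣ n - r q),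
                coreOn N θ (Set.Ioc ((N : ℝ) ^ (1 - η)) ((N : ℝ) ^ (1 + η)))
                  ((Ψ 0).eval (fun _ => n)).toNat ((Ψ 1).eval (fun _ => n)).toNat|
            else 0) ≤ (N : ℝ) / Real.log N ^ A

/-- Signature of `stub_moebiusSide`. -/
def Sig.stub_moebiusSide : Prop :=
    ∀ (L : ℕ) (θ ν A C η : ℝ), 0 < θ → 0 ≤ ν → ν + θ < 1 / 2 → 0 < A → 0 ≤ C → ν < η →
      ∃ N₀ : ℕ, ∀ N : ℕ, N₀ ≤ N → ∀ Ψ : Fin 2 → Literature.NumberTheory.Sieve.AffLinForm 1,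
        Literature.NumberTheory.Sieve.IsNondegenerateSystem Ψ →
        Literature.NumberTheory.Sieve.affLinSize Ψ N ≤ L →
        ∀ (r u v : ℕ → ℤ), (∀ q : ℕ, -(N : ℤ) ≤ u q ∧ v q ≤ N) →
          ∑ q ∈ Finset.Icc 1 ⌊(N : ℝ) ^ ν⌋₊, ((Nat.divisors q).card : ℝ) ^ C *
            (if ∀ i : Fin 2, ((Int.gcd ((Ψ i).eval (fun _ => r q)) q : ℕ) : ℝ) ≤ (N : ℝ) ^ (θ / 2) then
              |∑ n ∈ (Finset.Icc (u q) (v q)).filter (fun n : ℤ => (q : ℤ) ∣ n - r q),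
                coreOn N θ (Set.Ioi ((N : ℝ) ^ (1 + η)))
                  ((Ψ 0).eval (fun _ => n)).toNat ((Ψ 1).eval (fun _ => n)).toNat|
            else 0) ≤ (N : ℝ) / Real.log N ^ A

/-! ### Composition: the three stubs prove the crux BY NAME (real proof, no `sorry`) -/

/-- **BC3 composition.** `stub_smoothSide → stub_centre → stub_moebiusSide → PairCores`, the
conclusion being literally the route decl
`Summit.Parity.GeneralizedHardyLittlewood.Theses.DeterminantMoebiusCores.PairCores`. Proof: common
`η` from the centre stub, the three bounds at saving `A + 1`, the hyperbolic trichotomy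
`lamSharp_mul_split` (at `N^{1−η} ≤ N^{1+η}`), subadditivity of the tame `ℓ¹` frame
(`weighted_sum_le_of_split`), and `3N/(log N)^{A+1} ≤ N/(log N)^A` for `N ≥ 32`. -/
theorem PairCores_of :
    Sig.stub_smoothSide → Sig.stub_centre → Sig.stub_moebiusSide →
      Summit.Parity.GeneralizedHardyLittlewood.Theses.DeterminantMoebiusCores.PairCores := by
  intro hA hB hC L θ ν A C hθ hν hνθ hA0 hC0
  have hA1 : 0 < A + 1 := by linarith
  obtain ⟨η, hη, NB, hNB⟩ := hB L θ ν (A + 1) C hθ hν hνθ hA1 hC0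
  obtain ⟨NA, hNA⟩ := hA L θ ν (A + 1) C η hθ hν hνθ hA1 hC0 hη
  obtain ⟨NC, hNC⟩ := hC L θ ν (A + 1) C η hθ hν hνθ hA1 hC0 hη
  refine ⟨max (max NA (max NB NC)) 32, fun N hN Ψ hΨ hL r u v huv => ?_⟩
  have h32 : 32 ≤ N := le_trans (le_max_right _ _) hN
  have hN' : max NA (max NB NC) ≤ N := le_trans (le_max_left _ _) hN
  have hNA' : NA ≤ N := le_trans (le_max_left _ _) hN'
  have hNB' : NB ≤ N := le_trans (le_trans (le_max_left _ _) (le_max_right _ _)) hN'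
  have hNC' : NC ≤ N := le_trans (le_trans (le_max_right _ _) (le_max_right _ _)) hN'
  have bA := hNA N hNA' Ψ hΨ hL r u v huv
  have bB := hNB N hNB' Ψ hΨ hL r u v huv
  have bC := hNC N hNC' Ψ hΨ hL r u v huv
  have h1N : (1 : ℝ) ≤ (N : ℝ) := by exact_mod_cast (le_trans (by norm_num) h32 : 1 ≤ N)
  have hX : (N : ℝ) ^ (1 - η) ≤ (N : ℝ) ^ (1 + η) :=
    Real.rpow_le_rpow_of_exponent_le h1N (by linarith)
  refine le_trans (weighted_sum_le_of_split (fun q => Real.rpow_nonneg (Nat.cast_nonneg _) C)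
    (FA := fun q n => coreOn N θ (Set.Iic ((N : ℝ) ^ (1 - η)))
      ((Ψ 0).eval (fun _ => n)).toNat ((Ψ 1).eval (fun _ => n)).toNat)
    (FB := fun q n => coreOn N θ (Set.Ioc ((N : ℝ) ^ (1 - η)) ((N : ℝ) ^ (1 + η)))
      ((Ψ 0).eval (fun _ => n)).toNat ((Ψ 1).eval (fun _ => n)).toNat)
    (FC := fun q n => coreOn N θ (Set.Ioi ((N : ℝ) ^ (1 + η)))
      ((Ψ 0).eval (fun _ => n)).toNat ((Ψ 1).eval (fun _ => n)).toNat) ?_) ?_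
  · intro q hq n hn
    exact (Fin.prod_univ_two _).trans (lamSharp_mul_split N θ hX _ _)
  · exact le_trans (add_le_add_three bA bB bC) (three_terms_bound h32 A)

/-- The skeleton in its final shape: the crux BY NAME from the three registered stubs (it becomes a
proof of the crux when the last `stub_*` is discharged; until then it depends on `sorryAx` through
the stubs only — no `sorry` of its own). [bookkeeping] -/
theorem PairCores_proof :
    Summit.Parity.GeneralizedHardyLittlewood.Theses.DeterminantMoebiusCores.PairCores :=
  PairCores_of stub_smoothSide stub_centre stub_moebiusSide

end Summit.Parity.GeneralizedHardyLittlewood.Cruxes.PairCores.Birth
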